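import Literature.Geometry.Riemannian.HarmonicMapTensionField
import HarnessLib

/-!
# The energy decreases along the harmonic map heat flow (Eells–Sampson 1964, §6)
(topic `Geometry/Riemannian`)

Eells–Sampson 1964, §6 (B), p. 135: along a solution `u : [0, T) × M → N` of the heat equation
`∂ₜu = τ(u_t)` on a closed Riemannian manifold, "`dE(u_t)/dt = −∫_M |∂u/∂t|² *1 ≤ 0`", so the
energy is non-increasing, and it is stationary exactly at harmonic maps (Eells–Ratto 1993,
Ch. I (1.9)). With the first-variation formula `hasDerivAt_energy_stage_eq_neg_integral`
(`EnergyFirstVariation.lean`) and the characterisation `isHarmonicMap_iff_tensionField_eq_zero`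
(`HarmonicMapTensionField.lean`) we PROVE, for a `C^∞` family `u : ℝ × M → N` on a compact
Riemannian manifold without boundary modelled on `ℝ^m`, into a manifold without boundary points
with a `C^∞` pseudo-Riemannian metric `h`:

* `hasDerivAt_energy_of_heatFlow` — if `∂ₜu(t₀, ·) = τ(u_{t₀})` then
  `d/dt|_{t₀} E(u_t) = −∫_M h(τ(u_{t₀}), τ(u_{t₀})) dμ_g`;
* `energy_antitone_of_heatFlow` — for `h` Riemannian and a solution at all times, `t ↦ E(u_t)`
  is non-increasing;
* `tensionField_eq_zero_of_integral_eq_zero`, `isHarmonicMap_of_heatFlow_of_deriv_energy_eq_zero`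
  — for `h` Riemannian, `∫ h(τ(φ), τ(φ)) dμ_g = 0` forces `τ(φ) ≡ 0`; in particular a solution
  of the flow whose energy has zero derivative at `t₀` is harmonic at `t₀`.

Everything is proved; there are no definitions and no named facts.

## References

* J. Eells, J. H. Sampson, *Harmonic mappings of Riemannian manifolds*, Amer. J. Math. 86 (1964),
  §6 (B), p. 135. [EellsSampson1964]
* J. Eells, A. Ratto, *Harmonic Maps and Minimal Immersions with Symmetries* (1993), Ch. I (1.9).
  [EellsRatto1993]
-/

noncomputable section

open Bundle Set Function Filter MeasureTheory
open scoped Manifold ContDiff Topology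

namespace Literature.Geometry.Riemannian

open Lorentzian Lorentzian.PseudoRiemannianMetric

namespace HarmonicMap

variable {m : ℕ} {HM₂ : Type*} [TopologicalSpace HM₂]
  {IM₂ : ModelWithCorners ℝ (EuclideanSpace ℝ (Fin m)) HM₂} [IM₂.Boundaryless]
  {M₂ : Type*} [TopologicalSpace M₂] [ChartedSpace HM₂ M₂] [IsManifold IM₂ ∞ M₂]
  [CompactSpace M₂] [T3Space M₂] [MeasurableSpace M₂] [BorelSpace M₂]
  {EN : Type*} [NormedAddCommGroup EN] [NormedSpace ℝ EN] [FiniteDimensional ℝ EN]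
  [CompleteSpace EN] {HN : Type*} [TopologicalSpace HN] {IN : ModelWithCorners ℝ EN HN}
  {N : Type*} [TopologicalSpace N] [ChartedSpace HN N] [IsManifold IN ∞ N]
  (g : ContMDiffRiemannianMetric IM₂ ∞ (EuclideanSpace ℝ (Fin m)) (TangentSpace IM₂ : M₂ → Type _))
  [(ofRiemannian g).HasLeviCivita]
  (h : PseudoRiemannianMetric IN ∞ EN (TangentSpace IN : N → Type _)) [h.HasLeviCivita]

/-- **`dE(u_t)/dt = −∫ h(τ(u_t), τ(u_t)) dμ_g` along the heat flow** (Eells–Sampson 1964, §6 (B):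
"`dE/dt = −∫_M |∂u/∂t|² *1`"): if the `C^∞` family `u` satisfies `∂ₜu(t₀, x) = τ(u_{t₀})(x)` for
all `x`, the first-variation formula at `t₀` reads as displayed. [cite: EellsSampson1964, §6 (B)] -/
theorem hasDerivAt_energy_of_heatFlow {u : ℝ → M₂ → N}
    (hu : ContMDiff (𝓘(ℝ, ℝ).prod IM₂) IN ∞ (fun p : ℝ × M₂ ↦ u p.1 p.2)) {t₀ : ℝ}
    (hflow : ∀ x, velocity IN (fun t ↦ u t x) t₀ = tensionField g h (u t₀) x) :
    HasDerivAt (fun t ↦ energy g h (u t))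
      (-∫ x, h.val (u t₀ x) (tensionField g h (u t₀) x) (tensionField g h (u t₀) x)
        ∂riemannianMeasure g) t₀ := by
  have hd := hasDerivAt_energy_stage_eq_neg_integral h g hu t₀
  simp only [hflow] at hd
  exact hd

/-- **The energy is non-increasing along the heat flow into a Riemannian target**
(Eells–Sampson 1964, §6 (B)): for a `C^∞` family solving `∂ₜu = τ(u_t)` at all times,
`t ↦ E(u_t)` is antitone (`hasDerivAt_energy_of_heatFlow` and `h(τ, τ) ≥ 0`).
[cite: EellsSampson1964, §6 (B)] -/
theorem energy_antitone_of_heatFlow (hR : h.IsRiemannian) {u : ℝ → M₂ → N}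
    (hu : ContMDiff (𝓘(ℝ, ℝ).prod IM₂) IN ∞ (fun p : ℝ × M₂ ↦ u p.1 p.2))
    (hflow : ∀ t x, velocity IN (fun s ↦ u s x) t = tensionField g h (u t) x) :
    Antitone fun t ↦ energy g h (u t) := by
  have hd : ∀ t, HasDerivAt (fun t ↦ energy g h (u t))
      (-∫ x, h.val (u t x) (tensionField g h (u t) x) (tensionField g h (u t) x)
        ∂riemannianMeasure g) t := fun t ↦ hasDerivAt_energy_of_heatFlow g h hu (hflow t)
  refine antitone_of_deriv_nonpos (fun t ↦ (hd t).differentiableAt) fun t ↦ ?_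
  rw [(hd t).deriv, neg_nonpos]
  refine integral_nonneg fun x ↦ ?_
  by_cases hτ : tensionField g h (u t) x = 0
  · simp [hτ]
  · exact (hR _ _ hτ).le

/-- **`∫ h(τ(φ), τ(φ)) dμ_g = 0` forces `τ(φ) ≡ 0`** for a `C^∞` map into a Riemannian target:
the integrand is continuous (`contMDiff_val_tensionField`, `TensionFieldSmooth.lean`),
nonnegative, and the Riemannian measure charges open sets
(`isOpenPosMeasure_riemannianMeasure`). [cite: EellsSampson1964, §6 (B)] -/
theorem tensionField_eq_zero_of_integral_eq_zero (hR : h.IsRiemannian) {φ : M₂ → N}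
    (hφ : ContMDiff IM₂ IN ∞ φ)
    (hint : ∫ x, h.val (φ x) (tensionField g h φ x) (tensionField g h φ x) ∂riemannianMeasure g = 0)
    (x₀ : M₂) : tensionField g h φ x₀ = 0 := by
  set f : M₂ → ℝ := fun x ↦ h.val (φ x) (tensionField g h φ x) (tensionField g h φ x) with hf
  have hfc : Continuous f :=
    (contMDiff_val_tensionField h hφ g (contMDiff_lift_tensionField h hφ g)).continuous
  have hf0 : ∀ x, 0 ≤ f x := fun x ↦ by
    by_cases hτ : tensionField g h φ x = 0
    · simp [hf, hτ]
    · exact (hR _ _ hτ).le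
  haveI : IsFiniteMeasure (riemannianMeasure g) := isFiniteMeasure_riemannianMeasure' g
  haveI : (riemannianMeasure g).IsOpenPosMeasure := isOpenPosMeasure_riemannianMeasure g
  have hfi : Integrable f (riemannianMeasure g) :=
    hfc.integrable_of_hasCompactSupport (isClosed_tsupport _).isCompact
  by_contra hne
  have hpos : 0 < f x₀ := hR _ _ hne
  have hUo : IsOpen (f ⁻¹' Ioi 0) := isOpen_Ioi.preimage hfc
  have hlt : 0 < ∫ x, f x ∂riemannianMeasure g := by
    rw [integral_pos_iff_support_of_nonneg hf0 hfi]
    refine lt_of_lt_of_le (hUo.measure_pos (riemannianMeasure g) ⟨x₀, hpos⟩)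
      (measure_mono fun x hx ↦ ?_)
    rw [mem_support]
    exact ne_of_gt hx
  exact (lt_irrefl (0 : ℝ)) (hint ▸ hlt)

/-- **A solution of the heat flow with stationary energy is harmonic** (Eells–Sampson 1964,
§6 (B); Eells–Ratto 1993, Ch. I (1.9)): if `∂ₜu(t₀, ·) = τ(u_{t₀})` and `t ↦ E(u_t)` has
derivative `0` at `t₀`, then `τ(u_{t₀}) ≡ 0` and `u_{t₀}` is a harmonic map.
[cite: EellsSampson1964, §6 (B)] [cite: EellsRatto1993, Ch. I (1.9)] -/
theorem isHarmonicMap_of_heatFlow_of_deriv_energy_eq_zero [BoundarylessManifold IN N]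
    (hR : h.IsRiemannian) {u : ℝ → M₂ → N}
    (hu : ContMDiff (𝓘(ℝ, ℝ).prod IM₂) IN ∞ (fun p : ℝ × M₂ ↦ u p.1 p.2)) {t₀ : ℝ}
    (hflow : ∀ x, velocity IN (fun t ↦ u t x) t₀ = tensionField g h (u t₀) x)
    (hE : HasDerivAt (fun t ↦ energy g h (u t)) 0 t₀) :
    IsHarmonicMap g h (u t₀) := by
  have hut : ContMDiff IM₂ IN ∞ (u t₀) := contMDiff_stage hu t₀
  have hd := hasDerivAt_energy_of_heatFlow g h hu hflow
  have h0 : ∫ x, h.val (u t₀ x) (tensionField g h (u t₀) x) (tensionField g h (u t₀) x)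
      ∂riemannianMeasure g = 0 := by
    have := hd.unique hE
    linarith
  exact (isHarmonicMap_iff_tensionField_eq_zero g h).2
    ⟨hut, tensionField_eq_zero_of_integral_eq_zero g h hR hut h0⟩

end HarmonicMap

end Literature.Geometry.Riemannian

end
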